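import Summits.Ventures.Crystal3D.Theorems.StickyWulffConstantGenericWallFloorCoreResidual
import Summits.Ventures.Crystal3D.Theorems.StickyWulffConstantGenericWallFloorSigma9Tilt
import Summits.Ventures.Crystal3D.Theorems.StickyWulffConstantGenericWallFloorInPlaneTwinStarPairHolds
import HarnessLib

/-!
# The ray-aligned core of `GenericWallFloor` MINUS the four priced one-sided `Σ9` classes (the two of record and their
# TILTED-vertical extensions): the crux by name from `ExactOnly`(C12-55), `StarPairFar` and the re-shrunk residual
# (crux `GenericWallFloor`, stmt-Ventures-19480, line `WallLedgerG`)

HONEST FRAMING. Venture `Summits/Ventures/Crystal3D` (cell `crystal3d-full`), helper `--supports` the crux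
`GenericWallFloor` of `route-Ventures-StickyWulffConstant`, REGISTERED line `WallLedgerG`, open stub
`stub_twoSlabAdhesion`.  BOOKKEEPING CAPSTONE, rung credit only; F-C1 not moved; NOT the crux.

19480-p2 g5's `genericWallFloor_of_coreResidual` gives the route decl from `ExactOnly`(C12-55), `StarPairFar` and
`GenericWallFloorCoreResidual` (the crux's matrix on ray-aligned non-co-axial pairs outside the two `e₃` one-sided `Σ9`
classes).  This seat's tilted ledgers (`…Sigma9Tilt`) prove the matrix on the two one-sided classes with TILTED verticals
(word grain's in-plane slot of `e₃`-component `≥ 13/25`, other grain separated for its own tilted vertical) at charge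
`½(κ₁+κ₂)`, hence at `c₀ = 1` whenever `κ₁ + κ₂ ≥ 2`.  So the residual shrinks again:

* `Sigma9TiltAt A₁ A₂` / `Sigma9TiltDownAt A₁ A₂` — the hypothesis lists of `genericWallFloorAtCharge_sigma9{,Down}_tilt_of_far`
  together with the flux condition `κ₁ + κ₂ ≥ 2`;
* `GenericWallFloorCoreResidualTilt` — the crux's matrix on ray-aligned non-co-axial pairs OUTSIDE all four classes;
* **`genericWallFloor_of_coreResidualTilt`** — `ExactOnly`(C12-55) → `StarPairFar` → `GenericWallFloorCoreResidualTilt` →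
  `Summit.Ventures.Crystal3D.Theses.StickyWulffConstant.GenericWallFloor`, and the converse inclusion
  `genericWallFloorCoreResidualTilt_of_coreResidual` (nothing is smuggled).
Numerically (seat folder `calc/tilt_coverage.py`, 1500 Haar `Σ9` pairs): the four classes cover `≈ 94.5 %` of `Σ9` orientations
(the two `e₃` classes: `83 %`); the residual of the `Σ9` core is `≈ 5 %`.
WHAT THIS IS NOT: a proof of the residual; F-C1 not moved.
-/

noncomputable section

namespace Summit.Ventures.Crystal3D.Theorems

open Summit.Ventures.Crystal3D Finset
open Literature.MathematicalPhysics.StatisticalMechanics (fccStacking barlowStacking IsHaggSeq)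
open scoped InnerProductSpace

/-- **The lower one-sided `Σ9` class with TILTED verticals** (`Sigma9TiltAt A₁ A₂`): the hypothesis list of
`genericWallFloorAtCharge_sigma9_tilt_of_far` — unit verticals `z₁`, `z₂` within `1/4` of `e₃`, `−e₃`; a reduced
two-letter model menu word with `A₂·Λ₀ = (wordFrame A₁ [μk, μk1])·Λ₀`; a slot `u₁` of grain 1 steep for `z₁` IN the
first mirror plane; a slot `u₂` of grain 2 steep for `z₂` with the level-two condition read for `z₂`; and enough flux,
`√2|⟪A₁u₁,e₃⟫| + √2|⟪A₂u₂,e₃⟫| ≥ 2`, for the charge to reach the crux's `1`. -/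
def Sigma9TiltAt (A₁ A₂ : EuclideanSpace ℝ (Fin 3) ≃ₗᵢ[ℝ] EuclideanSpace ℝ (Fin 3)) : Prop :=
  ∃ (z₁ z₂ u₁ u₂ μk μk1 : EuclideanSpace ℝ (Fin 3)), ‖z₁‖ = 1 ∧ ‖z₁ - EuclideanSpace.single (2 : Fin 3) (1 : ℝ)‖ ≤ 1 / 4 ∧
    ‖z₂‖ = 1 ∧ ‖z₂ + EuclideanSpace.single (2 : Fin 3) (1 : ℝ)‖ ≤ 1 / 4 ∧
    u₁ ∈ fccSlots ∧ Real.sqrt 2 / 2 ≤ ⟪A₁ u₁, z₁⟫_ℝ ∧ u₂ ∈ fccSlots ∧ Real.sqrt 2 / 2 ≤ ⟪A₂ u₂, z₂⟫_ℝ ∧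
    2 ≤ Real.sqrt 2 * |⟪A₁ u₁, EuclideanSpace.single (2 : Fin 3) (1 : ℝ)⟫_ℝ| + Real.sqrt 2 * |⟪A₂ u₂, EuclideanSpace.single (2 : Fin 3) (1 : ℝ)⟫_ℝ| ∧
    (∀ μ ∈ [μk, μk1], ‖μ‖ = 1 ∧
      ∀ w ∈ fccSlots, ⟪w, μ⟫_ℝ = 0 ∨ ⟪w, μ⟫_ℝ = Real.sqrt (2 / 3) ∨ ⟪w, μ⟫_ℝ = -Real.sqrt (2 / 3)) ∧
    List.IsChain (fun μ μ' => ⟪μ, μ'⟫_ℝ = 1 / 3 ∨ ⟪μ, μ'⟫_ℝ = -1 / 3) [μk, μk1] ∧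
    A₂ '' fccStacking 1 (Real.sqrt (2 / 3)) = (wordFrame A₁ [μk, μk1]) '' fccStacking 1 (Real.sqrt (2 / 3)) ∧
    ⟪u₁, μk1⟫_ℝ = 0 ∧
    (∀ n₁ : EuclideanSpace ℝ (Fin 3),
      (n₁ = wordFrame A₁ [μk, μk1] μk ∨ n₁ = -wordFrame A₁ [μk, μk1] μk) → ⟪A₂ u₂, n₁⟫_ℝ = Real.sqrt (2 / 3) →
      ∀ q ∈ fccSlots, 0 < ⟪twinFrame A₂ n₁ q, n₁⟫_ℝ →
        (∀ q' ∈ fccSlots, 0 < ⟪twinFrame A₂ n₁ q', n₁⟫_ℝ → ⟪twinFrame A₂ n₁ q', z₂⟫_ℝ ≤ ⟪twinFrame A₂ n₁ q, z₂⟫_ℝ) →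
        (wordFrame A₁ [μk, μk1]).symm (A₂ ((twinFrame A₂ n₁).symm ((2 * Real.sqrt (2 / 3)) • twinFrame A₂ n₁ q - n₁))) ≠ μk1 ∧
        (wordFrame A₁ [μk, μk1]).symm (A₂ ((twinFrame A₂ n₁).symm ((2 * Real.sqrt (2 / 3)) • twinFrame A₂ n₁ q - n₁))) ≠ -μk1) ∧
    (∀ n₁ : EuclideanSpace ℝ (Fin 3),
      (n₁ = wordFrame A₁ [μk, μk1] μk ∨ n₁ = -wordFrame A₁ [μk, μk1] μk) → ⟪A₂ u₂, n₁⟫_ℝ = Real.sqrt (2 / 3) →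
      ∀ q ∈ fccSlots, 0 < ⟪twinFrame A₂ n₁ q, n₁⟫_ℝ →
        (∀ q' ∈ fccSlots, 0 < ⟪twinFrame A₂ n₁ q', n₁⟫_ℝ → ⟪twinFrame A₂ n₁ q', z₂⟫_ℝ ≤ ⟪twinFrame A₂ n₁ q, z₂⟫_ℝ) →
        ⟪twinFrame A₂ n₁ q, A₁ μk1⟫_ℝ = 0)

/-- **The upper one-sided `Σ9` class with TILTED verticals** (`Sigma9TiltDownAt A₁ A₂`, mirror image: grain 2
carries the word `A₁·Λ₀ = (wordFrame A₂ [μk, μk1])·Λ₀` and the in-plane slot, grain 1 the level-two condition read for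
`z₁`). -/
def Sigma9TiltDownAt (A₁ A₂ : EuclideanSpace ℝ (Fin 3) ≃ₗᵢ[ℝ] EuclideanSpace ℝ (Fin 3)) : Prop :=
  ∃ (z₁ z₂ u₁ u₂ μk μk1 : EuclideanSpace ℝ (Fin 3)), ‖z₁‖ = 1 ∧ ‖z₁ - EuclideanSpace.single (2 : Fin 3) (1 : ℝ)‖ ≤ 1 / 4 ∧
    ‖z₂‖ = 1 ∧ ‖z₂ + EuclideanSpace.single (2 : Fin 3) (1 : ℝ)‖ ≤ 1 / 4 ∧
    u₁ ∈ fccSlots ∧ Real.sqrt 2 / 2 ≤ ⟪A₁ u₁, z₁⟫_ℝ ∧ u₂ ∈ fccSlots ∧ Real.sqrt 2 / 2 ≤ ⟪A₂ u₂, z₂⟫_ℝ ∧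
    2 ≤ Real.sqrt 2 * |⟪A₁ u₁, EuclideanSpace.single (2 : Fin 3) (1 : ℝ)⟫_ℝ| + Real.sqrt 2 * |⟪A₂ u₂, EuclideanSpace.single (2 : Fin 3) (1 : ℝ)⟫_ℝ| ∧
    (∀ μ ∈ [μk, μk1], ‖μ‖ = 1 ∧
      ∀ w ∈ fccSlots, ⟪w, μ⟫_ℝ = 0 ∨ ⟪w, μ⟫_ℝ = Real.sqrt (2 / 3) ∨ ⟪w, μ⟫_ℝ = -Real.sqrt (2 / 3)) ∧
    List.IsChain (fun μ μ' => ⟪μ, μ'⟫_ℝ = 1 / 3 ∨ ⟪μ, μ'⟫_ℝ = -1 / 3) [μk, μk1] ∧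
    A₁ '' fccStacking 1 (Real.sqrt (2 / 3)) = (wordFrame A₂ [μk, μk1]) '' fccStacking 1 (Real.sqrt (2 / 3)) ∧
    ⟪u₂, μk1⟫_ℝ = 0 ∧
    (∀ n₁ : EuclideanSpace ℝ (Fin 3),
      (n₁ = wordFrame A₂ [μk, μk1] μk ∨ n₁ = -wordFrame A₂ [μk, μk1] μk) → ⟪A₁ u₁, n₁⟫_ℝ = Real.sqrt (2 / 3) →
      ∀ q ∈ fccSlots, 0 < ⟪twinFrame A₁ n₁ q, n₁⟫_ℝ →
        (∀ q' ∈ fccSlots, 0 < ⟪twinFrame A₁ n₁ q', n₁⟫_ℝ → ⟪twinFrame A₁ n₁ q', z₁⟫_ℝ ≤ ⟪twinFrame A₁ n₁ q, z₁⟫_ℝ) →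
        (wordFrame A₂ [μk, μk1]).symm (A₁ ((twinFrame A₁ n₁).symm ((2 * Real.sqrt (2 / 3)) • twinFrame A₁ n₁ q - n₁))) ≠ μk1 ∧
        (wordFrame A₂ [μk, μk1]).symm (A₁ ((twinFrame A₁ n₁).symm ((2 * Real.sqrt (2 / 3)) • twinFrame A₁ n₁ q - n₁))) ≠ -μk1) ∧
    (∀ n₁ : EuclideanSpace ℝ (Fin 3),
      (n₁ = wordFrame A₂ [μk, μk1] μk ∨ n₁ = -wordFrame A₂ [μk, μk1] μk) → ⟪A₁ u₁, n₁⟫_ℝ = Real.sqrt (2 / 3) →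
      ∀ q ∈ fccSlots, 0 < ⟪twinFrame A₁ n₁ q, n₁⟫_ℝ →
        (∀ q' ∈ fccSlots, 0 < ⟪twinFrame A₁ n₁ q', n₁⟫_ℝ → ⟪twinFrame A₁ n₁ q', z₁⟫_ℝ ≤ ⟪twinFrame A₁ n₁ q, z₁⟫_ℝ) →
        ⟪twinFrame A₁ n₁ q, A₂ μk1⟫_ℝ = 0)

/-- **The RE-SHRUNK residual of lane G**: the crux's matrix, verbatim, on every non-co-axial RAY-ALIGNED pair that lies
in NONE of the four priced one-sided `Σ9` classes (the two of record and their tilted extensions). -/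
def GenericWallFloorCoreResidualTilt : Prop :=
  ∀ (A₁ : EuclideanSpace ℝ (Fin 3) ≃ₗᵢ[ℝ] EuclideanSpace ℝ (Fin 3)) (t₁ : EuclideanSpace ℝ (Fin 3))
    (A₂ : EuclideanSpace ℝ (Fin 3) ≃ₗᵢ[ℝ] EuclideanSpace ℝ (Fin 3)) (t₂ : EuclideanSpace ℝ (Fin 3)),
    ¬ (∃ (L : EuclideanSpace ℝ (Fin 3) ≃ₗᵢ[ℝ] EuclideanSpace ℝ (Fin 3)) (s₁ s₂ : EuclideanSpace ℝ (Fin 3))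
        (σ σ' : ℤ → ℤ), IsHaggSeq σ ∧ IsHaggSeq σ' ∧
        (fun p => A₁ p + t₁) '' fccStacking 1 (Real.sqrt (2 / 3)) ⊆
          (fun p => L p + s₁) '' barlowStacking 1 (Real.sqrt (2 / 3)) σ ∧
        (fun p => A₂ p + t₂) '' fccStacking 1 (Real.sqrt (2 / 3)) ⊆
          (fun p => L p + s₂) '' barlowStacking 1 (Real.sqrt (2 / 3)) σ') →
    RayAlignedAt A₁ A₂ → ¬ Sigma9OneSidedAt A₁ A₂ → ¬ Sigma9OneSidedDownAt A₁ A₂ →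
    ¬ Sigma9TiltAt A₁ A₂ → ¬ Sigma9TiltDownAt A₁ A₂ → GenericWallFloorAt A₁ t₁ A₂ t₂

/-- Pairs in the lower tilted `Σ9` class satisfy the crux's matrix (modulo `ExactOnly`(C12-55), `StarPairFar`). -/
theorem genericWallFloorAt_of_sigma9TiltAt
    {s₀ : EuclideanSpace ℝ (Fin 3)} (hs₀ : s₀ ∈ fccSlots)
    (hcert : ExactOnly 0 (fccSlots.filter fun w => 0 < ⟪w, s₀⟫_ℝ)) (hfar : StarPairFar)
    {A₁ A₂ : EuclideanSpace ℝ (Fin 3) ≃ₗᵢ[ℝ] EuclideanSpace ℝ (Fin 3)} (h : Sigma9TiltAt A₁ A₂)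
    (t₁ t₂ : EuclideanSpace ℝ (Fin 3)) : GenericWallFloorAt A₁ t₁ A₂ t₂ := by
  obtain ⟨z₁, z₂, u₁, u₂, μk, μk1, hz₁, hze₁, hz₂, hze₂, hu₁, hsteep₁, hu₂, hsteep₂, hflux, hκl, hκc, hA₂, hfirst,
    hsecond, hcap⟩ := h
  exact genericWallFloorAt_of_charge_one (genericWallFloorAtCharge_mono (by linarith only [hflux])
    (genericWallFloorAtCharge_sigma9_tilt_of_far hs₀ hcert hfar inPlaneTwinStarPair_holds A₁ t₁ A₂ t₂ hz₁ hze₁ hz₂ hze₂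
      hu₁ hsteep₁ hu₂ hsteep₂ μk μk1 hκl hκc hA₂ hfirst hsecond hcap))

/-- Pairs in the upper tilted `Σ9` class satisfy the crux's matrix (modulo `ExactOnly`(C12-55), `StarPairFar`). -/
theorem genericWallFloorAt_of_sigma9TiltDownAt
    {s₀ : EuclideanSpace ℝ (Fin 3)} (hs₀ : s₀ ∈ fccSlots)
    (hcert : ExactOnly 0 (fccSlots.filter fun w => 0 < ⟪w, s₀⟫_ℝ)) (hfar : StarPairFar)
    {A₁ A₂ : EuclideanSpace ℝ (Fin 3) ≃ₗᵢ[ℝ] EuclideanSpace ℝ (Fin 3)} (h : Sigma9TiltDownAt A₁ A₂)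
    (t₁ t₂ : EuclideanSpace ℝ (Fin 3)) : GenericWallFloorAt A₁ t₁ A₂ t₂ := by
  obtain ⟨z₁, z₂, u₁, u₂, μk, μk1, hz₁, hze₁, hz₂, hze₂, hu₁, hsteep₁, hu₂, hsteep₂, hflux, hκl, hκc, hA₁, hfirst,
    hsecond, hcap⟩ := h
  exact genericWallFloorAt_of_charge_one (genericWallFloorAtCharge_mono (by linarith only [hflux])
    (genericWallFloorAtCharge_sigma9Down_tilt_of_far hs₀ hcert hfar inPlaneTwinStarPair_holds A₁ t₁ A₂ t₂ hz₁ hze₁ hz₂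
      hze₂ hu₁ hsteep₁ hu₂ hsteep₂ μk μk1 hκl hκc hA₁ hfirst hsecond hcap))

/-- **The crux BY NAME from `ExactOnly`(C12-55), `StarPairFar` and the RE-SHRUNK residual.** -/
theorem genericWallFloor_of_coreResidualTilt
    {s₀ : EuclideanSpace ℝ (Fin 3)} (hs₀ : s₀ ∈ fccSlots)
    (hcert : ExactOnly 0 (fccSlots.filter fun w => 0 < ⟪w, s₀⟫_ℝ)) (hfar : StarPairFar)
    (hres : GenericWallFloorCoreResidualTilt) :
    Summit.Ventures.Crystal3D.Theses.StickyWulffConstant.GenericWallFloor := by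
  refine genericWallFloor_of_coreResidual hs₀ hcert hfar fun A₁ t₁ A₂ t₂ hnc hra h₁ h₂ => ?_
  by_cases h₃ : Sigma9TiltAt A₁ A₂
  · exact genericWallFloorAt_of_sigma9TiltAt hs₀ hcert hfar h₃ t₁ t₂
  by_cases h₄ : Sigma9TiltDownAt A₁ A₂
  · exact genericWallFloorAt_of_sigma9TiltDownAt hs₀ hcert hfar h₄ t₁ t₂
  exact hres A₁ t₁ A₂ t₂ hnc hra h₁ h₂ h₃ h₄

/-- The re-shrunk residual is implied by the previous one (and hence by the crux): nothing is smuggled. -/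
theorem genericWallFloorCoreResidualTilt_of_coreResidual (h : GenericWallFloorCoreResidual) :
    GenericWallFloorCoreResidualTilt :=
  fun A₁ t₁ A₂ t₂ hnc hra h₁ h₂ _ _ => h A₁ t₁ A₂ t₂ hnc hra h₁ h₂

/-- The crux implies the re-shrunk residual. -/
theorem genericWallFloorCoreResidualTilt_of_genericWallFloor
    (h : Summit.Ventures.Crystal3D.Theses.StickyWulffConstant.GenericWallFloor) : GenericWallFloorCoreResidualTilt :=
  genericWallFloorCoreResidualTilt_of_coreResidual (genericWallFloorCoreResidual_of_genericWallFloor h)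

end Summit.Ventures.Crystal3D.Theorems

end
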